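import Summits.ABC.IUTFork.Thm311RealIsmDHStableLattices
import Literature.IUT.LogVolume.UnitLogUnramifiedDyadicStabilizer
import Literature.IUT.LogVolume.RescaledCompletionInvariants
import HarnessLib

/-!
# [IUTchIII] Cor. 3.12, TEAM R `indFixes` thread: UNIT multiples `u·I_v` of the log-shell at UNRAMIFIED DYADIC
# places — (Ind2)-stable iff `u ≡ 1 (mod 2)`; moved whenever `f(v|2) ≥ 2` and `ū ∉ 𝔽₂`

PROOF-ONLY file (0 definitions, 0 named facts) of the abc-iut cell (WAVE-5 prover seat abc-iut-w5-d014, gen 4;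
abc-iut-w5-d216's successor item (ii) «unramified `p = 2`, `f ≥ 2`: the shell is not a ball», residue-field half,
carried to R1's literal signature `∃ φ ∈ Real.ismDH logv (.inr v), φ '' (c • I_v) ≠ c • I_v`; TEAM R lead
abc-iut-c312-14 = R1).  TAKES NO SIDE on [IUTchIII] Cor. 3.12.

abc-iut-w5-d039's `forall_ismDH_image_smul_shell_iff` (p433488) decides, at every finite place `v ∣ p` where `logv`
is the analytic logarithm, which shell multiples `c • I_v` the Dupuy–Hilado (Ind2) group `Real.ismDH logv (inr v)`
fixes: exactly those with `c • I_v = p^k • I_v`; hence every `c` with `e(v|p) ∤ ord_v(c)` is moved.  For a UNIT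
`c` (`ord_v(c) = 0`) that criterion reads `c • log_p(𝒪_v^×) = log_p(𝒪_v^×)` (§1, any `p`:
`smul_logUnits_eq_zpow_smul_of_forall_ismDH_image`, `forall_ismDH_image_smul_shell_iff_smul_logUnits_eq_of_norm_eq_one`),
a condition on the unit stabiliser of the log-shell which the sibling Literature file
`UnitLogUnramifiedDyadicStabilizer` computes at the UNRAMIFIED DYADIC places (`e(v|2) = 1`, any `f`):
`u • log₂(𝒪_v^×) = log₂(𝒪_v^×) ↔ ‖u − 1‖ < 1`.  Hence (§2):

* **`forall_ismDH_image_smul_shell_iff_norm_sub_one_lt`** — at a place `v ∣ 2` with `e(v|2) = 1`, `logv`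
  analytic, for every unit `u` of `K_v`: ALL of `Real.ismDH logv (inr v)` fix `u • I_v` **iff `u ≡ 1 (mod 2𝒪_v)`**;
* **`exists_unit_ismDH_moves_smul_shell`** — if moreover `f(v|2) ≥ 2`, some UNIT `u` (any unit with residue
  `∉ 𝔽₂`) has `u • I_v` MOVED by a member of `Real.ismDH logv (inr v)` — although multiplication by a unit fixes
  every ball: at these places the obstruction is the Artin–Schreier shape `log₂(𝒪_v^×) = 2·℘(𝒪_v) + 4𝒪_v` of the
  shell, not a valuation;
* `exists_unit_ismDH_moves_smul_shell_analyticLogv` — the same at the analytic family of record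
  `Real.analyticLogv F`, hypotheses in global terms `v.asIdeal.ramificationIdx ℤ = 1`, `2 ≤ v.asIdeal.inertiaDeg ℤ`
  (abc-iut-S7's `absRamificationIdx_rescaledCompletion` / `residueDegree_rescaledCompletion`).

(For `f(v|2) = 1`, e.g. every place of `ℚ` or a place with `K_v = ℚ₂`, every unit is `≡ 1 (mod 2)` and nothing
moves — abc-iut-w5-d216's `Thm311RealIsmDHDegOne`.)  Classical local analysis over the cell's typed (Ind2) group;
nothing here decides which reading of [IUTchIII] Thm. 3.11 (i) (Ind2) is print's.
[cite: DupuyHilado2025, §4.9] [cite: NeukirchANT1999, Ch. II Prop. (5.5)] [claim: Mochizuki2012, status: disputed]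
for every [IUTchIII] locution.
-/

noncomputable section

open Set Metric NumberField IsDedekindDomain
open scoped Pointwise

namespace Summit.ABC.IUTFork.Thm311.Real

open Literature.IUT.LogVolume Literature.IUT.LogThetaLattice Literature.NumberTheory.NumberFields
open Literature.NumberTheory.GaloisRepresentations.Ultrametric

variable {F : Type} [Field F] [NumberField F]

/-! ## 1. Any `p`: for a UNIT `c`, (Ind2)-stability of `c • I_v` means `c • log_p(𝒪_v^×) = log_p(𝒪_v^×)` -/

section AnyPrime

variable {p : ℕ} [hp : Fact p.Prime]
variable (v : HeightOneSpectrum (𝓞 F)) (hv : ((p : ℕ) : 𝓞 F) ∈ v.asIdeal)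

include hv in
/-- **Stability ⇒ `c • log_p(𝒪_v^×) = p^k • log_p(𝒪_v^×)`** (`c ≠ 0`, `logv` analytic at `v ∣ p`): the lattice form
of abc-iut-w5-d039's criterion `forall_ismDH_image_smul_shell_iff`, read in abc-iut-S7's rescaled completion
(`I_v = (p^*)⁻¹ • log_p(𝒪_v^×)`, `Cor312VolumesRealDH.mem_shell_iff_mem_smul_logUnits`).
[cite: DupuyHilado2025, §4.9] [cite: WeilBNT1967, Ch. II §2, Th. 1] -/
theorem smul_logUnits_eq_zpow_smul_of_forall_ismDH_image {logv : PadicLogs F} (hlog : LogvAnalyticAt p logv)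
    {c : Carrier (.inr v : Place F)} (hc : c ≠ 0)
    (hfix : ∀ g ∈ ismDH logv (.inr v : Place F),
      ⇑g '' (c • shell logv (.inr v : Place F)) = c • shell logv (.inr v : Place F)) :
    ∃ k : ℤ, (toR p v hv c) • logUnits (RescaledCompletion F p v hv) =
      ((p : ℚ_[p]) ^ k) • logUnits (RescaledCompletion F p v hv) := by
  set K := RescaledCompletion F p v hv
  have hps0 : ((pStar p : ℕ) : ℚ_[p]) ≠ 0 := Nat.cast_ne_zero.mpr (pStar_ne_zero hp.out.ne_zero)
  obtain ⟨k, hk⟩ := (forall_ismDH_image_smul_shell_iff v hv hlog c hc).mp hfix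
  have hshell : (shell logv (.inr v) : Set (Carrier (.inr v : Place F))) =
      ((((pStar p : ℕ) : ℚ_[p])⁻¹ • logUnits K : Set K)) :=
    Set.ext fun x => mem_shell_iff_mem_smul_logUnits v hv hlog x
  have h1 : (c • shell logv (.inr v) : Set (Carrier (.inr v : Place F))) =
      ((toR p v hv c) • ((((pStar p : ℕ) : ℚ_[p])⁻¹ • logUnits K)) : Set K) := by
    rw [hshell]; rfl
  rw [h1, zpow_prime_smul_set_carrier_eq v hv k hshell, smul_comm (toR p v hv c),
    smul_comm ((p : ℚ_[p]) ^ k)] at hk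
  refine ⟨k, ?_⟩
  have := congrArg (fun T : Set K => (((pStar p : ℕ) : ℚ_[p])⁻¹)⁻¹ • T) hk
  simpa only [smul_smul, inv_mul_cancel₀ (inv_ne_zero hps0), one_smul,
    inv_mul_cancel_left₀ (inv_ne_zero hps0)] using this

include hv in
/-- **For a UNIT `c`, stability means `c • log_p(𝒪_v^×) = log_p(𝒪_v^×)`**: if all of `Real.ismDH logv (inr v)` fix
`c • I_v` and `‖c‖ = 1` (rescaled norm), then `c • log_p(𝒪_v^×) = log_p(𝒪_v^×)` (`c • Λ = p^k • Λ` forces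
`‖c‖ = p^{-k}`, abc-iut-w5-d039's `norm_eq_zpow_of_smul_logUnits_eq`, so `k = 0`).
[cite: DupuyHilado2025, §4.9] [cite: WeilBNT1967, Ch. II §2, Th. 2] -/
theorem smul_logUnits_eq_of_forall_ismDH_image_of_norm_eq_one {logv : PadicLogs F} (hlog : LogvAnalyticAt p logv)
    {c : Carrier (.inr v : Place F)} (hn : ‖toR p v hv c‖ = 1)
    (hfix : ∀ g ∈ ismDH logv (.inr v : Place F),
      ⇑g '' (c • shell logv (.inr v : Place F)) = c • shell logv (.inr v : Place F)) :
    (toR p v hv c) • logUnits (RescaledCompletion F p v hv) = logUnits (RescaledCompletion F p v hv) := by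
  have hcR : toR p v hv c ≠ 0 := norm_pos_iff.mp (by rw [hn]; exact one_pos)
  have hc : c ≠ 0 := hcR
  obtain ⟨k, hk⟩ := smul_logUnits_eq_zpow_smul_of_forall_ismDH_image v hv hlog hc hfix
  have hnk := norm_eq_zpow_of_smul_logUnits_eq p v hv hcR hk
  rw [hn] at hnk
  have hp1 : (1 : ℝ) < p := by exact_mod_cast hp.out.one_lt
  have hk0 : k = 0 := by
    have h := (zpow_right_injective₀ (by positivity) hp1.ne').eq_iff.mp
      (show (p : ℝ) ^ (-k) = (p : ℝ) ^ (0 : ℤ) by rw [zpow_zero]; exact hnk.symm)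
    omega
  rw [hk, hk0, zpow_zero, one_smul]

include hv in
/-- **Criterion for UNIT multiples** (any `p`, `logv` analytic at `v ∣ p`, `‖c‖ = 1`): ALL of
`Real.ismDH logv (inr v)` fix `c • I_v` iff `c • log_p(𝒪_v^×) = log_p(𝒪_v^×)`.
[cite: DupuyHilado2025, §4.9] [cite: WeilBNT1967, Ch. II §2, Th. 1] -/
theorem forall_ismDH_image_smul_shell_iff_smul_logUnits_eq_of_norm_eq_one {logv : PadicLogs F}
    (hlog : LogvAnalyticAt p logv) {c : Carrier (.inr v : Place F)} (hn : ‖toR p v hv c‖ = 1) :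
    (∀ g ∈ ismDH logv (.inr v : Place F),
        ⇑g '' (c • shell logv (.inr v : Place F)) = c • shell logv (.inr v : Place F)) ↔
      (toR p v hv c) • logUnits (RescaledCompletion F p v hv) = logUnits (RescaledCompletion F p v hv) := by
  have hcR : toR p v hv c ≠ 0 := norm_pos_iff.mp (by rw [hn]; exact one_pos)
  have hc : c ≠ 0 := hcR
  refine ⟨smul_logUnits_eq_of_forall_ismDH_image_of_norm_eq_one v hv hlog hn, fun h => ?_⟩
  refine (forall_ismDH_image_smul_shell_iff v hv hlog c hc).mpr ⟨0, ?_⟩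
  set K := RescaledCompletion F p v hv
  have hshell : (shell logv (.inr v) : Set (Carrier (.inr v : Place F))) =
      ((((pStar p : ℕ) : ℚ_[p])⁻¹ • logUnits K : Set K)) :=
    Set.ext fun x => mem_shell_iff_mem_smul_logUnits v hv hlog x
  have h1 : (c • shell logv (.inr v) : Set (Carrier (.inr v : Place F))) =
      ((toR p v hv c) • ((((pStar p : ℕ) : ℚ_[p])⁻¹ • logUnits K)) : Set K) := by
    rw [hshell]; rfl
  rw [h1, zpow_prime_smul_set_carrier_eq v hv 0 hshell, smul_comm (toR p v hv c), h, zpow_zero, one_smul]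

end AnyPrime

/-! ## 2. Unramified dyadic places: unit multiples are stable iff `u ≡ 1 (mod 2)`; movers for `f ≥ 2` -/

section Dyadic

variable (v : HeightOneSpectrum (𝓞 F)) (hv : ((2 : ℕ) : 𝓞 F) ∈ v.asIdeal)

include hv in
/-- **UNIT MULTIPLES AT AN UNRAMIFIED DYADIC PLACE: stable iff `u ≡ 1 (mod 2)`.**  At a place `v ∣ 2` with
`e(v|2) = 1` where `logv` is the analytic logarithm, for every unit `u` of `K_v` (`‖u‖ = 1`): all of
`Real.ismDH logv (inr v)` fix `u • I_v` iff `‖u − 1‖ < 1` (the unit stabiliser of `log₂(𝒪_v^×) = 2·℘(𝒪_v) + 4𝒪_v`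
is `1 + 2𝒪_v`, `UnramifiedDyadic.smul_logUnits_eq_iff_norm_sub_one_lt`).
[cite: DupuyHilado2025, §4.9] [cite: NeukirchANT1999, Ch. II Prop. (5.5)] -/
theorem forall_ismDH_image_smul_shell_iff_norm_sub_one_lt {logv : PadicLogs F} (hlog : LogvAnalyticAt 2 logv)
    (he : absRamificationIdx 2 (RescaledCompletion F 2 v hv) = 1) {u : Carrier (.inr v : Place F)}
    (hn : ‖toR 2 v hv u‖ = 1) :
    (∀ g ∈ ismDH logv (.inr v : Place F),
        ⇑g '' (u • shell logv (.inr v : Place F)) = u • shell logv (.inr v : Place F)) ↔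
      ‖toR 2 v hv u - 1‖ < 1 := by
  rw [forall_ismDH_image_smul_shell_iff_smul_logUnits_eq_of_norm_eq_one v hv hlog hn]
  exact UnramifiedDyadic.smul_logUnits_eq_iff_norm_sub_one_lt he hn

include hv in
/-- **A UNIT MOVER AT EVERY UNRAMIFIED DYADIC PLACE OF RESIDUE DEGREE `≥ 2`.**  At a place `v ∣ 2` with
`e(v|2) = 1`, `f(v|2) ≥ 2` and `logv` analytic there are a UNIT `u` of `K_v` (any unit with residue `∉ 𝔽₂`) and
`g ∈ Real.ismDH logv (inr v)` with `g '' (u • I_v) ≠ u • I_v` (`UnramifiedDyadic.exists_unit_smul_logUnits_ne`).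
[cite: DupuyHilado2025, §4.9] [cite: NeukirchANT1999, Ch. II Prop. (5.5)] -/
theorem exists_unit_ismDH_moves_smul_shell {logv : PadicLogs F} (hlog : LogvAnalyticAt 2 logv)
    (he : absRamificationIdx 2 (RescaledCompletion F 2 v hv) = 1)
    (hf : 2 ≤ residueDegree 2 (RescaledCompletion F 2 v hv)) :
    ∃ u : Carrier (.inr v : Place F), ‖toR 2 v hv u‖ = 1 ∧
      ∃ g ∈ ismDH logv (.inr v : Place F),
        ⇑g '' (u • shell logv (.inr v : Place F)) ≠ u • shell logv (.inr v : Place F) := by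
  obtain ⟨u, hu1, hne⟩ := UnramifiedDyadic.exists_unit_smul_logUnits_ne (K := RescaledCompletion F 2 v hv) he hf
  refine ⟨ofR 2 v hv u, hu1, ?_⟩
  by_contra h
  push Not at h
  exact hne (smul_logUnits_eq_of_forall_ismDH_image_of_norm_eq_one v hv hlog (c := ofR 2 v hv u) hu1 h)

/-- **At the analytic family of record** (abc-iut-c312-1's `Real.analyticLogv`), in global terms: at every finite
place `v` of a number field with `2 ∈ v`, `e(v|2) = 1` and `f(v|2) ≥ 2` some UNIT multiple `u • I_v` of the
log-shell is moved by a member of `Real.ismDH (analyticLogv F) (inr v)`.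
[cite: DupuyHilado2025, §4.9] [cite: NeukirchANT1999, Ch. II Prop. (6.8)] -/
theorem exists_unit_ismDH_moves_smul_shell_analyticLogv (he : v.asIdeal.ramificationIdx ℤ = 1)
    (hf : 2 ≤ v.asIdeal.inertiaDeg ℤ) :
    ∃ u : Carrier (.inr v : Place F), ‖toR 2 v hv u‖ = 1 ∧
      ∃ φ ∈ ismDH (analyticLogv F) (.inr v : Place F),
        ⇑φ '' (u • shell (analyticLogv F) (.inr v : Place F)) ≠
          u • shell (analyticLogv F) (.inr v : Place F) := by
  haveI : Fact (Nat.Prime 2) := ⟨Nat.prime_two⟩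
  have he' : absRamificationIdx 2 (RescaledCompletion F 2 v hv) = 1 := by
    rw [absRamificationIdx_rescaledCompletion F 2 v hv, he]
  have hf' : 2 ≤ residueDegree 2 (RescaledCompletion F 2 v hv) := by
    rw [residueDegree_rescaledCompletion F 2 v hv]; exact hf
  exact exists_unit_ismDH_moves_smul_shell v hv (logvAnalyticAt_analyticLogv 2) he' hf'

end Dyadic

end Summit.ABC.IUTFork.Thm311.Real

end
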